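import Summits.HodgeConjecture.HodgeConjecture.Theorems.F0P2tThetaPairNeZeroOfFrame      -- ★ (N5) frame signs `h₁V_of_frame` ∕ `hV_of_frame` ∕ `re_pos_dV_of_frame` (+ ★ (N4) by import)
import Literature.AlgebraicGeometry.Liu2021.AdmissibleElement                              -- `IsAdmissibleElement` (the letter's admissible representative)
import HarnessLib

/-!
# Crux `H413`, programme P2 — letter NV-GEN of the THETA LIFT CUT, CLOSED MODULO ONE NAMED ARCHIMEDEAN INPUT (A2 of PLAN-P2 v14)

Cell hodgecm-mathlib (D-0151), FLOOR 0, crux item H413 = stmt-HodgeConjecture-24833 (`HCCMUnconditional.H413`); programme P2, books #173 (Θ-OCC-GEN).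
Author F0P2-p06 (g8), BRIEF N of the desk's PLAN-P2 v14 (F0P2-plan (g13), 2026-09-01T13:23Z) §2 A2 «NV closer».  `--supports stmt-HodgeConjecture-24833`
(helper; THEOREMS ONLY — no definition, no instance, no `sorry`; 0 `Lines` imports).  HC_CM is proved only modulo the 2 remaining named inputs (hLiu418,
h413) until rung 0 closes; this file discharges no printed citation by itself.

## What is proved

**`thetaLiftNonvanishingGen_of_archFixed : ‹ARCH-FIXED-GEN› → ‹NV-GEN›`.**

* The CONCLUSION is the TEXT of the letter NV-GEN — the body of `def StubThetaLiftNonvanishingGen` of the OCC♭-GEN ED. 3 «THETA LIFT CUT» candidate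
  (desk F0P2-plan (g13), `F0/P2/F0_P2OccFlatGeneral.prewrite.ed3.F0P2-plan-g13.lean` :240–269; = binder `hN` of ★-candidate (b1)
  `Theorems/F0P2sThetaOccursInGenOfThetaLift`), pasted token for token (ws-normalised sha16 `956536782677dbfd`): at every CM frame of the line, for `μ`
  conjugate-symplectic of weight one, `χ ∈ Chi`, an ADMISSIBLE REPRESENTATIVE `a = e · 2·imagUnit` (`e` `Φ_μ`-admissible [Liu2021, Def. 4.11–4.12]) and
  ANY theta data (majorants `hρ`, compact `[U(diag d_V)]`, a finite invariant Borel measure `μ_W` on `[U(⟨a⟩)]` charging open sets), SOME pure tensor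
  `φ ⊗ Φ_f` has a non-zero global theta lift `Θ_(φ ⊗ Φ_f)(χ̃_χ)` on `U(diag d_V)(𝔸_(L⁺))` — [Liu2021, Prop. 4.13 proof p. 49 «Conversely» (l. 2145–2149)],
  inputs the Rallis inner product formula [Rallis1984] ∕ [Li1992, Thm. 2.1 (26)].
* The HYPOTHESIS `hA` is ONE named archimedean input, «ARCH-FIXED-GEN» = the output of PLAN-P2 v14 §2 A1 (ARCH-PAIR-GEN, BRIEF A) in the binder shape of
  ★ (N4) `F0P2tLineThetaLiftNeZeroOfArchFixed` (hypothesis `hE`): at every CM frame and admissible representative there is an archimedean Schwartz vector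
  `φ` on `(L⁺ ⊗ ℝ)^(3×1)` with `R_(e₁) φ ≠ 0` which is FIXED by `U(⟨a⟩)(L⁺ ⊗ ℝ)` under the archimedean Weil representation at the `χ_μ`-splitting
  (`archWeilRep … (chiSplittingLine …) … (1, a′) (R_(e₁) φ) = R_(e₁) φ`) — the trivial `U(1)_∞`-isotypic vector of [Liu2021, App. D §D.1 Step 3, Lem. D.2]
  ∕ [KonnoKonno2007, Thm. 5.4] (a Gaussian at the definite places, Gaussian × harmonic at `ι`), which exists exactly at the admissible signs.  Until A1
  lands this theorem is CONDITIONAL on `hA` (O50-1 shape: the hypothesis is a displayed text, not a `def … : Prop`); the minute A1 proves `hA`'s text,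
  `stub_thetaLiftNonvanishingGen := thetaLiftNonvanishingGen_of_archFixed A1` closes NV-GEN by name.

## The proof (every step a ★ declaration BY NAME)

Given the frame and the data, take `φ` from `hA`; ★ (N5) `h₁V_of_frame` ∕ `hV_of_frame` ∕ `re_pos_dV_of_frame` (Sylvester at the frame) and ★
`UnitaryGroup.exists_infinitePlace_ne` (a place `τ ≠ ι`, from `2 ≤ [L⁺:ℚ]`) feed ★ (N4) `lineThetaLift_tmul_charCM_chiQuot_ne_zero_of_archFixed`
(= ★ (N2) a non-zero `χ_f`-coefficient [Liu2021, p. 49] + ★ (N3) Rallis' identity (26) for `lineThetaKernelDatum` [Li1992] + ★ brick 7 + the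
arch-fixed vector): SOME `Φ_f` has `Θ_(R_(e₁)φ ⊗ Φ_f)(χ̃_χ) ≠ 0` in `L²`; a non-zero class has a non-zero value `Θ(ȳ)`, and ★ `piSBReindex_tmul` +
`thetaLiftFun_apply` rewrite it as the value at `y⁻¹` of the letter's function `Θ̃_(R_(e₁)(φ ⊗ R_(e₁)⁻¹Φ_f))(χ̃_χ)`.  MEASURE-GENERICITY is free: ★ (N4) is
already stated for every finite invariant open-positive `μ_W` (no Haar uniqueness needed).  Field-degree guard: the frame hypothesis `2 ≤ [L⁺:ℚ]`.
-/

set_option autoImplicit false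

noncomputable section

open scoped ComplexConjugate Matrix ComplexOrder TensorProduct SchwartzMap NNReal Classical
open MeasureTheory MeasureTheory.Measure NumberField NumberField.InfinitePlace IsDedekindDomain
open Literature.NumberTheory.Automorphic Literature.NumberTheory.Automorphic.UnitaryGroup
open Literature.NumberTheory.Automorphic.IdeleClassGroup
open Literature.NumberTheory.Automorphic.Liu2021 Literature.NumberTheory.Automorphic.Liu2021.Def411WeilCarriers
open Literature.NumberTheory.Automorphic.Liu2021.Def411WeilCarriersDoubling
open Literature.NumberTheory.Weil1964 Literature.NumberTheory.Li1992
open Literature.NumberTheory.GelbartRogawski1991 Literature.NumberTheory.GelbartRogawski1991.UnitaryDualPair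
open Literature.NumberTheory.GelbartRogawski1991.UnitaryDualPair.WeilCoinv
open Literature.NumberTheory.GaloisRepresentations (HeckeCharacter)
open Literature.RepresentationTheory.HarrisKudlaSweet1996 (IsSplittingChar)
open Literature.RepresentationTheory.Liu2021
open Literature.RepresentationTheory.CompactGroups (charCM)
open Literature.AlgebraicGeometry.ShimuraVarieties
open Literature.AlgebraicGeometry.Liu2021 (IsAdmissibleElement)
open Literature.NumberTheory.QuadraticForms
open Summit.HodgeConjecture.HodgeConjecture.Cruxes.H413

namespace Summit.HodgeConjecture.HodgeConjecture.Cruxes.H413.F0P2tThetaLiftNonvanishingGen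

/-- the field-degree guard: `2 ≤ [L⁺:ℚ]` gives `4 ≤ [L:ℚ]` (`[L:L⁺] = 2`). [folklore] -/
private theorem four_le_finrank_of_two_le' (L : Type) [Field L] [NumberField L] [IsCMField L]
    (h2 : 2 ≤ Module.finrank ℚ ↥(maximalRealSubfield L)) : 4 ≤ Module.finrank ℚ L := by
  have h := Module.finrank_mul_finrank ℚ ↥(maximalRealSubfield L) L
  rw [Algebra.IsQuadraticExtension.finrank_eq_two ↥(maximalRealSubfield L) L] at h
  omega

set_option synthInstance.maxHeartbeats 400000 in
set_option maxHeartbeats 8000000 in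
-- heartbeats: the statement carries the brick-7 telescope of ★ (N4) at the `splittingDatum` of the line (same budget as ★ (N4)/(N5)).
/-- **NV-GEN FROM ONE NAMED ARCHIMEDEAN INPUT — `‹ARCH-FIXED-GEN› → ‹NV-GEN›`.**  Conclusion = the TEXT of `StubThetaLiftNonvanishingGen` (OCC♭-GEN ED. 3
candidate :240–269, ws-sha16 `956536782677dbfd`) verbatim; hypothesis `hA` = ARCH-FIXED-GEN (PLAN-P2 v14 §2 A1's output in ★ (N4)'s `hE` shape): a non-zero archimedean
Schwartz vector fixed by `U(⟨a⟩)(L⁺ ⊗ ℝ)` under `archWeilRep` at the `χ_μ`-splitting, at every CM frame and admissible representative.  Proof: ★ (N5) frame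
signs ▸ ★ (N4) `lineThetaLift_tmul_charCM_chiQuot_ne_zero_of_archFixed` ▸ ★ `piSBReindex_tmul`, `thetaLiftFun_apply`.  See the module docstring.
[cite: Liu2021, proof of Prop. 4.13 (p. 49 «Conversely», l. 2145–2149); Def. 4.11–4.12 p. 47; App. D §D.1 Step 3, Lem. D.2 p. 126]
[cite: Li1992, p. 178, Thm 2.1 (26)–(27) p. 184] [cite: KonnoKonno2007, Thm. 5.4 p. 75] [cite: GelbartRogawski1991, §3.1 Prop. 3.1.1 p. 455] -/
theorem thetaLiftNonvanishingGen_of_archFixed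
    (hA :
      ∀ (L : Type) [Field L] [NumberField L] [IsCMField L] (ι : L →+* ℂ) (H : Matrix (Fin 3) (Fin 3) L) (T : GL (Fin 3) ℂ)
      (hT : (T : Matrix (Fin 3) (Fin 3) ℂ)ᴴ * H.map ι * (T : Matrix (Fin 3) (Fin 3) ℂ) = Literature.Geometry.ComplexHyperbolic.BallModel.J),
      (∀ τ' : L →+* ℂ, InfinitePlace.mk τ' ≠ InfinitePlace.mk ι → (H.map τ').PosDef) → 2 ≤ Module.finrank ℚ ↥(maximalRealSubfield L) →
      ∀ {n' : ℕ} (e₁ : Fin 3 × Fin 1 ≃ Fin n') (dV : Fin 3 → L) (hdV : ∀ i, IsCMField.complexConj L (dV i) = dV i)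
      (hdV0 : ∀ i, dV i ≠ 0) (g : GL (Fin 3) L)
      (hg : ((g : Matrix (Fin 3) (Fin 3) L).map (cmConjRingHom L))ᵀ * H * (g : Matrix (Fin 3) (Fin 3) L) = Matrix.diagonal dV)
      (μ : Literature.NumberTheory.Automorphic.IdeleClassGroup L →ₜ* Circle) (hμ : IsConjugateSymplectic L μ), HasWeight L μ 1 →
      ∀ (a : (↥(maximalRealSubfield L))ˣ) (e : L), IsAdmissibleElement L hμ.cmType.1 e →
      ((a : ↥(maximalRealSubfield L)) : L) = e * (2 * imagUnit L) →
      ∃ φ : 𝓢(((Fin 3 × Fin 1) → NumberField.mixedEmbedding.mixedSpace ↥(maximalRealSubfield L)), ℂ),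
        schwartzReindexCLM (↥(maximalRealSubfield L)) e₁ φ ≠ 0 ∧
        ∀ a' : UnitaryGroup.arch (↥(maximalRealSubfield L)) L (IsCMField.complexConj L) 1 (JW (↥(maximalRealSubfield L)) L a),
          HodgeCM.Model.HypCensus.archWeilRep (↥(maximalRealSubfield L)) L (IsCMField.complexConj L) 3 1 (Matrix.diagonal dV)
            (JW (↥(maximalRealSubfield L)) L a) (complexConj_imagUnit L) (imagUnit_ne_zero L) (imagUnit_mul_self L) (realDiagonal_isSymm L dV hdV)
            (isSymm_TW (↥(maximalRealSubfield L)) a) (isUnit_det_realDiagonal L dV hdV hdV0) (isUnit_det_TW (↥(maximalRealSubfield L)) a)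
            (realDiagonal_map L dV hdV).symm (JW_eq (↥(maximalRealSubfield L)) L a) e₁
            (chiSplittingLine L e₁ dV hdV hdV0 (toHeckeCharacter L μ) (isUnitary_toHeckeCharacter L μ)
              ((isOscillatorChar_toHeckeCharacter_iff μ).mpr hμ) (TW (↥(maximalRealSubfield L)) a)
              (isUnit_det_TW (↥(maximalRealSubfield L)) a) (JW (↥(maximalRealSubfield L)) L a) (JW_eq (↥(maximalRealSubfield L)) L a))
            (ThetaNonvanishing.proj_apply_eq_toSp (↥(maximalRealSubfield L)) L (IsCMField.complexConj L) 3 1 e₁ (Matrix.diagonal dV)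
              (JW (↥(maximalRealSubfield L)) L a) (complexConj_imagUnit L) (imagUnit_ne_zero L) (imagUnit_mul_self L) (realDiagonal_isSymm L dV hdV)
              (isSymm_TW (↥(maximalRealSubfield L)) a) (isUnit_det_realDiagonal L dV hdV hdV0) (isUnit_det_TW (↥(maximalRealSubfield L)) a)
              (realDiagonal_map L dV hdV).symm (JW_eq (↥(maximalRealSubfield L)) L a)
              (isCompatible_chiSplittingLine L e₁ dV hdV hdV0 (toHeckeCharacter L μ) (isUnitary_toHeckeCharacter L μ)
                ((isOscillatorChar_toHeckeCharacter_iff μ).mpr hμ) (TW (↥(maximalRealSubfield L)) a) (isSymm_TW (↥(maximalRealSubfield L)) a)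
                (isUnit_det_TW (↥(maximalRealSubfield L)) a) (JW (↥(maximalRealSubfield L)) L a) (JW_eq (↥(maximalRealSubfield L)) L a)))
            (1, a') (schwartzReindexCLM (↥(maximalRealSubfield L)) e₁ φ) = schwartzReindexCLM (↥(maximalRealSubfield L)) e₁ φ) :
    ∀ (L : Type) [Field L] [NumberField L] [IsCMField L] (ι : L →+* ℂ) (H : Matrix (Fin 3) (Fin 3) L) (T : GL (Fin 3) ℂ)
    (hT : (T : Matrix (Fin 3) (Fin 3) ℂ)ᴴ * H.map ι * (T : Matrix (Fin 3) (Fin 3) ℂ) = Literature.Geometry.ComplexHyperbolic.BallModel.J),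
    (∀ τ' : L →+* ℂ, InfinitePlace.mk τ' ≠ InfinitePlace.mk ι → (H.map τ').PosDef) → 2 ≤ Module.finrank ℚ ↥(maximalRealSubfield L) →
    ∀ {n' : ℕ} (e₁ : Fin 3 × Fin 1 ≃ Fin n') (dV : Fin 3 → L) (hdV : ∀ i, IsCMField.complexConj L (dV i) = dV i)
    (hdV0 : ∀ i, dV i ≠ 0) (g : GL (Fin 3) L)
    (hg : ((g : Matrix (Fin 3) (Fin 3) L).map (cmConjRingHom L))ᵀ * H * (g : Matrix (Fin 3) (Fin 3) L) = Matrix.diagonal dV)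
    (μ : Literature.NumberTheory.Automorphic.IdeleClassGroup L →ₜ* Circle) (hμ : IsConjugateSymplectic L μ), HasWeight L μ 1 →
    ∀ (a : (↥(maximalRealSubfield L))ˣ) (χ : Chi (↥(maximalRealSubfield L)) L (IsCMField.complexConj L)) (e : L), IsAdmissibleElement L hμ.cmType.1 e →
    ((a : ↥(maximalRealSubfield L)) : L) = e * (2 * imagUnit L) →
    ∀ (hρ : HasThetaMajorants fun
    (p : ↥(UnitaryGroup.adelic (↥(maximalRealSubfield L)) L (IsCMField.complexConj L) 3 (Matrix.diagonal dV)) × ↥(UnitaryGroup.adelic (↥(maximalRealSubfield L)) L (IsCMField.complexConj L) 1 (JW (↥(maximalRealSubfield L)) L a))) (Φ : piSchwartzBruhat (↥(maximalRealSubfield L)) (Fin n')) =>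
    pairRep (↥(maximalRealSubfield L)) L (IsCMField.complexConj L) 3 1 e₁ (Matrix.diagonal dV) (JW (↥(maximalRealSubfield L)) L a)
    (chiSplittingLine L e₁ dV hdV hdV0 (toHeckeCharacter L μ) (isUnitary_toHeckeCharacter L μ)
    ((isOscillatorChar_toHeckeCharacter_iff μ).mpr hμ) (TW (↥(maximalRealSubfield L)) a)
    (isUnit_det_TW (↥(maximalRealSubfield L)) a) (JW (↥(maximalRealSubfield L)) L a) (JW_eq (↥(maximalRealSubfield L)) L a))
    p Φ)
    [CompactSpace (↥(UnitaryGroup.adelic (↥(maximalRealSubfield L)) L (IsCMField.complexConj L) 3 (Matrix.diagonal dV)) ⧸ (UnitaryGroup.toAdelic (↥(maximalRealSubfield L)) L (IsCMField.complexConj L) 3 (Matrix.diagonal dV)).range)]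
    [MeasurableSpace (↥(UnitaryGroup.adelic (↥(maximalRealSubfield L)) L (IsCMField.complexConj L) 1 (JW (↥(maximalRealSubfield L)) L a)) ⧸ (UnitaryGroup.toAdelic (↥(maximalRealSubfield L)) L (IsCMField.complexConj L) 1 (JW (↥(maximalRealSubfield L)) L a)).range)]
    [BorelSpace (↥(UnitaryGroup.adelic (↥(maximalRealSubfield L)) L (IsCMField.complexConj L) 1 (JW (↥(maximalRealSubfield L)) L a)) ⧸ (UnitaryGroup.toAdelic (↥(maximalRealSubfield L)) L (IsCMField.complexConj L) 1 (JW (↥(maximalRealSubfield L)) L a)).range)]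
    (μW : Measure (↥(UnitaryGroup.adelic (↥(maximalRealSubfield L)) L (IsCMField.complexConj L) 1 (JW (↥(maximalRealSubfield L)) L a)) ⧸ (UnitaryGroup.toAdelic (↥(maximalRealSubfield L)) L (IsCMField.complexConj L) 1 (JW (↥(maximalRealSubfield L)) L a)).range)) [IsFiniteMeasure μW]
    [SMulInvariantMeasure ↥(UnitaryGroup.adelic (↥(maximalRealSubfield L)) L (IsCMField.complexConj L) 1 (JW (↥(maximalRealSubfield L)) L a))
    (↥(UnitaryGroup.adelic (↥(maximalRealSubfield L)) L (IsCMField.complexConj L) 1 (JW (↥(maximalRealSubfield L)) L a)) ⧸ (UnitaryGroup.toAdelic (↥(maximalRealSubfield L)) L (IsCMField.complexConj L) 1 (JW (↥(maximalRealSubfield L)) L a)).range) μW]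
    [μW.IsOpenPosMeasure],
    haveI := normal_range_toAdelic_JW L a
    ∃ (φ : 𝓢(((Fin 3 × Fin 1) → NumberField.mixedEmbedding.mixedSpace ↥(maximalRealSubfield L)), ℂ)) (Φf : FinSB (↥(maximalRealSubfield L)) (Fin 3 × Fin 1)),
    (lineThetaKernelDatum L 3 e₁ dV hdV hdV0 μ hμ a hρ).thetaLiftFun μW
    (piSBReindex (↥(maximalRealSubfield L)) e₁ (piSchwartzBruhatEquiv (↥(maximalRealSubfield L)) (Fin 3 × Fin 1) (φ ⊗ₜ[ℂ] Φf)))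
    (charCM (chiQuot (↥(maximalRealSubfield L)) L (IsCMField.complexConj L) (Algebra.IsQuadraticExtension.finrank_eq_two _ L)
    (IsCMField.complexConj_ne_one (K := L)) a χ)) ≠ 0 := by
  intro L _ _ _ ι H T hT hpos h2 n' e₁ dV hdV hdV0 g hg μ hμ hw a χ e he hae hρ _ _ _ μW _ _ _
  haveI := normal_range_toAdelic_JW L a
  -- the named archimedean input at this frame and representative
  obtain ⟨φ, hφ, hE⟩ := hA L ι H T hT hpos h2 e₁ dV hdV hdV0 g hg μ hμ hw a e he hae
  -- `3 ≤ n'` from the reindexing `e₁`, and a place `τ ≠ ι` from `2 ≤ [L⁺:ℚ]`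
  have h3 : 3 ≤ n' := by
    have hc := Fintype.card_congr e₁
    simp only [Fintype.card_prod, Fintype.card_fin] at hc
    omega
  obtain ⟨τ, hτ⟩ := UnitaryGroup.exists_infinitePlace_ne L (four_le_finrank_of_two_le' L h2) ι
  -- ★ (N4) at the frame's sign facts (★ (N5)): some `Φ_f` with a non-zero `L²` theta lift of `R φ ⊗ Φ_f`
  obtain ⟨Φf, hne⟩ :=
    F0P2tLineThetaLiftNeZeroOfArchFixed.lineThetaLift_tmul_charCM_chiQuot_ne_zero_of_archFixed L e₁ dV hdV hdV0
      (by norm_num) h3 μ hμ a ι (F0P2tThetaPairNeZeroOfFrame.h₁V_of_frame L ι H T hT dV hdV g hg)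
      (F0P2tThetaPairNeZeroOfFrame.hV_of_frame L ι H hpos dV g hg) τ
      (F0P2tThetaPairNeZeroOfFrame.re_pos_dV_of_frame L ι H hpos dV g hg τ hτ) hρ μW χ hφ hE
  -- a non-zero `L²`-class has a non-zero value at some class `ȳ`; read it on the group at `y⁻¹` after undoing the reindexing
  obtain ⟨q, hq⟩ := DFunLike.ne_iff.mp hne
  obtain ⟨y, rfl⟩ := QuotientGroup.mk_surjective q
  refine ⟨φ, (finSBReindex (↥(maximalRealSubfield L)) e₁).symm Φf, fun h0 => hq ?_⟩
  have h1 := congrFun h0 y⁻¹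
  rw [piSBReindex_tmul, LinearEquiv.apply_symm_apply, ThetaKernelDatum.thetaLiftFun_apply, inv_inv] at h1
  exact h1

end Summit.HodgeConjecture.HodgeConjecture.Cruxes.H413.F0P2tThetaLiftNonvanishingGen

end
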